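import Mathlib

/-!
# `Capture` (stmt-PneNP-2659, route PneNP/ConvexRankGates) — negative-side lemmas: permutation constraints, I (the criterion)

Standing-adversary (cdisprove, gen 3 / cycle 3) output for the crux
`Summit.PneNP.PneNP.Theses.ConvexRankGates.Capture`, aimed at the registered stub
`stub_cosetMeetToJoinNonabelian` of the picked line `csp-spine-meet-to-join` (the nonabelian DOOR TEST).
Part I locates the test by settling the FUNCTIONAL part of the coset stratum combinatorially:

* `PermCSP`, `PermCSP.Sat`, `PermCSP.Step`/`Reach` (cover graph on `V × D`), `PermCSP.Bad` — a menu of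
  PERMUTATION constraints `h(dst j) = p_j (h(src j))`; every functional binary coset constraint over ANY group
  (holonomy, two-sided, automorphism-twisted: `mem_coset_graph_iff`) and every Unique-Games-type constraint.
* `PermCSP.not_sat_iff_bad` — **UNSAT of the selected sub-system ⟺ `∃ x, ∀ a, ∃ a' ≠ a, (x,a) ~ (x,a')`**
  (`Reach.lift`, `Good.transport`); the right-hand side is monotone in the selection (`Bad.mono`). Part II
  (`PermConstraintsCircuit.lean`) turns it into a polynomial `{∧₂,∨₂,0,1}`-circuit; Part III (`DoorD4.lean`)
  exhibits the first genuine RELATIONAL test instance. The docstring of `PermCSP.not_sat_iff_bad` records the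
  `S₃` roadmap and the `D₄` residue (paper).

Refuter seat cdisprove-stmt-PneNP-2659-g3, 2026-08-16. Crux work file: `Cruxes/Capture/Disproof.lean` §16.
-/

set_option linter.dupNamespace false -- `Summit.PneNP.PneNP.…`: summit = sub-problem (D-0017)

namespace Summit.PneNP.PneNP.Theorems.Capture.Negative

section PermCSP

variable {V D J : Type*}

/-- A menu of PERMUTATION CONSTRAINTS on variables `V` with domain `D`: constraint `j` demands
`h (dst j) = perm j (h (src j))`. Every binary coset constraint whose subgroup `H ≤ G × G` is the graph
of a bijection (holonomy `h(y) = c·h(x)`, two-sided `h(y) = c·h(x)·d`, automorphism-twisted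
`h(y) = c·φ(h(x))`), and every Unique-Games-type constraint, is of this form. [folklore] -/
structure PermCSP (V D J : Type*) where
  /-- source variable of constraint `j` -/
  src : J → V
  /-- target variable of constraint `j` -/
  dst : J → V
  /-- the bijection of the domain imposed by constraint `j` -/
  perm : J → Equiv.Perm D

variable (P : PermCSP V D J)

/-- The SELECTED sub-system `S` is satisfiable. [folklore] -/
def PermCSP.Sat (S : Set J) : Prop :=
  ∃ h : V → D, ∀ j ∈ S, h (P.dst j) = P.perm j (h (P.src j))

/-- One step in the COVER GRAPH on `V × D` of the selected sub-system: along constraint `j ∈ S`,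
`(src j, a) — (dst j, perm j a)`, in both directions. [folklore] -/
inductive PermCSP.Step (S : Set J) : V × D → V × D → Prop
  | fwd (j : J) (hj : j ∈ S) (a : D) : PermCSP.Step S (P.src j, a) (P.dst j, P.perm j a)
  | bwd (j : J) (hj : j ∈ S) (a : D) : PermCSP.Step S (P.dst j, P.perm j a) (P.src j, a)

/-- Connectivity in the cover graph. [folklore] -/
def PermCSP.Reach (S : Set J) : V × D → V × D → Prop := Relation.ReflTransGen (P.Step S)

/-- The monotone UNSAT witness: some fibre has NO "good" point, i.e. from every `(x, a)` one reaches
another point `(x, a')` of the same fibre. [folklore] -/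
def PermCSP.Bad (S : Set J) : Prop :=
  ∃ x : V, ∀ a : D, ∃ a' : D, a' ≠ a ∧ P.Reach S (x, a) (x, a')

variable {P}

/-- The cover graph is undirected. [folklore] -/
theorem PermCSP.step_symm {S : Set J} {p q : V × D} (h : P.Step S p q) : P.Step S q p := by
  cases h with
  | fwd j hj a => exact .bwd j hj a
  | bwd j hj a => exact .fwd j hj a

/-- Reachability is symmetric. [folklore] -/
theorem PermCSP.Reach.symm {S : Set J} {p q : V × D} (h : P.Reach S p q) : P.Reach S q p := by
  induction h with
  | refl => exact Relation.ReflTransGen.refl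
  | tail _ hs ih => exact Relation.ReflTransGen.head (PermCSP.step_symm hs) ih

/-- Reachability is transitive. [folklore] -/
theorem PermCSP.Reach.trans {S : Set J} {p q r : V × D} (h₁ : P.Reach S p q) (h₂ : P.Reach S q r) :
    P.Reach S p r :=
  Relation.ReflTransGen.trans h₁ h₂

/-- Steps are monotone in the selection. [folklore] -/
theorem PermCSP.Step.mono {S T : Set J} (hST : S ⊆ T) {p q : V × D} (h : P.Step S p q) : P.Step T p q := by
  cases h with
  | fwd j hj a => exact .fwd j (hST hj) a
  | bwd j hj a => exact .bwd j (hST hj) a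

/-- Reachability is MONOTONE in the selection (more constraints, more edges). [folklore] -/
theorem PermCSP.Reach.mono {S T : Set J} (hST : S ⊆ T) {p q : V × D} (h : P.Reach S p q) :
    P.Reach T p q := by
  induction h with
  | refl => exact Relation.ReflTransGen.refl
  | tail _ hs ih => exact Relation.ReflTransGen.tail ih (PermCSP.Step.mono hST hs)

/-- Hence the witness `Bad` is monotone in the selection. [folklore] -/
theorem PermCSP.Bad.mono {S T : Set J} (hST : S ⊆ T) (h : P.Bad S) : P.Bad T := by
  obtain ⟨x, hx⟩ := h
  refine ⟨x, fun a => ?_⟩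
  obtain ⟨a', ha', hr⟩ := hx a
  exact ⟨a', ha', hr.mono hST⟩

/-- Along a solution `h`, everything reachable from `(x, h x)` lies on the graph of `h`. [folklore] -/
theorem PermCSP.Reach.eq_of_sat {S : Set J} {h : V → D}
    (hsat : ∀ j ∈ S, h (P.dst j) = P.perm j (h (P.src j))) {x : V} {q : V × D}
    (hr : P.Reach S (x, h x) q) : q.2 = h q.1 := by
  induction hr with
  | refl => rfl
  | tail _ hs ih =>
    cases hs with
    | fwd j hj a =>
      simp only at ih ⊢
      rw [hsat j hj, ← ih]
    | bwd j hj a =>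
      simp only at ih ⊢
      rw [hsat j hj] at ih
      exact (P.perm j).injective ih

/-- **Soundness of the witness**: `Bad S → ¬ Sat S`. [folklore] -/
theorem PermCSP.not_sat_of_bad {S : Set J} (hb : P.Bad S) : ¬ P.Sat S := by
  rintro ⟨h, hsat⟩
  obtain ⟨x, hx⟩ := hb
  obtain ⟨a', ha', hr⟩ := hx (h x)
  exact ha' (PermCSP.Reach.eq_of_sat hsat hr)

/-- **Path lifting**: a path from `(x, a)` to `(y, b)` acts on the whole fibre by ONE permutation `π`
with `π a = b` (the holonomy of its projection). [folklore] -/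
theorem PermCSP.Reach.lift {S : Set J} {x y : V} {a b : D} (hr : P.Reach S (x, a) (y, b)) :
    ∃ π : Equiv.Perm D, π a = b ∧ ∀ c : D, P.Reach S (x, c) (y, π c) := by
  -- generalise the endpoints to run the induction
  suffices ∀ q : V × D, P.Reach S (x, a) q →
      ∃ π : Equiv.Perm D, π a = q.2 ∧ ∀ c : D, P.Reach S (x, c) (q.1, π c) from this _ hr
  intro q hq
  induction hq with
  | refl => exact ⟨1, rfl, fun c => Relation.ReflTransGen.refl⟩
  | tail _ hs ih =>
    obtain ⟨π, hπ, hall⟩ := ih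
    cases hs with
    | fwd j hj a₀ =>
      simp only at hπ hall
      refine ⟨π.trans (P.perm j), ?_, fun c => ?_⟩
      · simp only [Equiv.trans_apply]
        rw [hπ]
      · simp only [Equiv.trans_apply]
        exact (hall c).tail (.fwd j hj (π c))
    | bwd j hj a₀ =>
      simp only at hπ hall
      refine ⟨π.trans (P.perm j).symm, ?_, fun c => ?_⟩
      · simp only [Equiv.trans_apply]
        rw [hπ, Equiv.symm_apply_apply]
      · simp only [Equiv.trans_apply]
        have h2 : P.Step S (P.dst j, π c) (P.src j, (P.perm j).symm (π c)) := by
          have := PermCSP.Step.bwd (P := P) (S := S) j hj ((P.perm j).symm (π c))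
          rwa [Equiv.apply_symm_apply] at this
        exact (hall c).tail h2

/-- A GOOD point of the fibre of `x`: its component meets the fibre only in itself. [folklore] -/
def PermCSP.Good (S : Set J) (x : V) (a : D) : Prop :=
  ∀ a' : D, P.Reach S (x, a) (x, a') → a' = a

/-- Goodness is transported along paths. [folklore] -/
theorem PermCSP.Good.transport {S : Set J} {x y : V} {a b : D} (hg : P.Good S x a)
    (hr : P.Reach S (x, a) (y, b)) : P.Good S y b := by
  intro b' hb'
  obtain ⟨π, hπa, hall⟩ := hr.lift
  have h1 : P.Reach S (x, a) (y, b') := hr.trans hb'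
  have h2 : P.Reach S (x, π.symm b') (y, b') := by
    have := hall (π.symm b')
    rwa [Equiv.apply_symm_apply] at this
  have h3 : P.Reach S (x, a) (x, π.symm b') := h1.trans h2.symm
  have h4 := hg _ h3
  rw [Equiv.symm_apply_eq] at h4
  rw [h4, hπa]

/-- Base connectivity (projection of the cover graph). [folklore] -/
def PermCSP.Conn (S : Set J) (x y : V) : Prop := ∃ a b : D, P.Reach S (x, a) (y, b)

/-- From a connected base point every fibre point lifts. [folklore] -/
theorem PermCSP.Conn.reach {S : Set J} {x y : V} (h : P.Conn S x y) (c : D) :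
    ∃ d : D, P.Reach S (x, c) (y, d) := by
  obtain ⟨a, b, hr⟩ := h
  obtain ⟨π, -, hall⟩ := hr.lift
  exact ⟨π c, hall c⟩

/-- Base connectivity is an equivalence relation on the variables met by the domain. [folklore] -/
theorem PermCSP.conn_equivalence [Nonempty D] (S : Set J) : Equivalence (P.Conn S) where
  refl x := let ⟨a⟩ := ‹Nonempty D›; ⟨a, a, Relation.ReflTransGen.refl⟩
  symm := fun ⟨a, b, h⟩ => ⟨b, a, h.symm⟩
  trans := fun ⟨a, b, h₁⟩ h₂ => by
    obtain ⟨d, hd⟩ := PermCSP.Conn.reach h₂ b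
    exact ⟨a, d, h₁.trans hd⟩

/-- **Completeness of the witness**: if every fibre has a good point, the selected system is
satisfiable — pick a good point over one representative of each base component and transport it
(well defined because goodness is transported and lifts are unique at good points). [folklore] -/
theorem PermCSP.sat_of_not_bad {S : Set J} (hb : ¬ P.Bad S) : P.Sat S := by
  classical
  simp only [PermCSP.Bad, not_exists, not_forall, not_and] at hb
  -- `g x` is good at `x`
  choose g hg using hb
  have hgood : ∀ x, P.Good S x (g x) := fun x a' hr => by
    by_contra h
    exact hg x a' h hr
  cases isEmpty_or_nonempty D with
  | inl hD =>
    -- no domain element: then there is no variable either (else `hb` produced one)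
    refine ⟨fun x => (hD.false (g x)).elim, fun j _ => (hD.false (g (P.src j))).elim⟩
  | inr hD =>
    -- representatives of base components
    let E : Setoid V := ⟨P.Conn S, PermCSP.conn_equivalence S⟩
    let ρ : V → V := fun x => (Quotient.mk E x).out
    have hρ : ∀ x, P.Conn S (ρ x) x := fun x => Quotient.mk_out (s := E) x
    have hρeq : ∀ x y, P.Conn S x y → ρ x = ρ y := fun x y hxy => by
      show (Quotient.mk E x).out = (Quotient.mk E y).out
      rw [Quotient.sound (s := E) hxy]
    -- transport the good value of the representative
    have hex : ∀ x, ∃ c : D, P.Reach S (ρ x, g (ρ x)) (x, c) := fun x => (hρ x).reach _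
    choose h hh using hex
    have huniq : ∀ x c, P.Reach S (ρ x, g (ρ x)) (x, c) → c = h x := fun x c hc => by
      have hgx : P.Good S x (h x) := (hgood (ρ x)).transport (hh x)
      exact hgx c ((hh x).symm.trans hc)
    refine ⟨h, fun j hj => ?_⟩
    have hconn : P.Conn S (P.src j) (P.dst j) :=
      ⟨g (P.src j), _, Relation.ReflTransGen.single (.fwd j hj _)⟩
    have hρj : ρ (P.dst j) = ρ (P.src j) := (hρeq _ _ hconn).symm
    refine (huniq (P.dst j) _ ?_).symm
    rw [hρj]
    exact (hh (P.src j)).tail (.fwd j hj _)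

/-- **UNSAT of a selected system of permutation constraints is the monotone connectivity condition
`Bad`** — so it is decided by cover-graph `STCONN` queries combined positively
(`∃ x, ∀ a, ∃ a' ≠ a, Reach`), i.e. by a polynomial-size `{∧₂, ∨₂}`-circuit in the selection (STCONN on
`|V|·|D|` vertices has monotone circuits of size `O((|V||D|)³)`; assembling them is routine). For the line
`csp-spine-meet-to-join`: the nonabelian door test `stub_cosetMeetToJoinNonabelian` is NOT decided by
functional (holonomy / automorphism-twisted / two-sided) coset constraints, over any group — those never
need a PERM gate; the test lives in the RELATIONAL constraints through abelian sections (arity `≥ 3`, or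
quotient-couplings), twisted by the group. Already over `S₃`: a ternary coupling
`{u ∈ 𝔽₃³ : u₁+u₂+u₃ = 0} ⋊ ⟨(τ,τ,τ)⟩ ≤ S₃³` and its conjugates (each single constraint is conjugate to a
split one, `H¹ = 0` by coprimality) tie the SIGN classes of the coupled variables and shift the
`𝔽₃`-equation by a multiple of that common sign bit; UNSAT of a selected system is then "`𝔽₂`-system on the
signs + per coupling-component a two-case `𝔽₃`-system". ROADMAP for this `S₃` case (paper, for the lead;
a 3-level `{∧,∨} ∪ PERM` circuit, polynomial): (1) DOUBLE COVER — two `𝔽₃`-unknowns `u_y⁰, u_y¹` per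
variable ("`u_y` if `s_y = 0 / 1`") and each twisted equation written once per value of its class bit; this
is a plain selected `𝔽₃`-linear system `Σ̃(S)` whose restriction to a tie-component is the disjoint union of
the two case-systems (its two sheets); (2) LOCALISED INFEASIBILITY `Inf(y,β)(S)` := "the component of
`u_y^β` in `Σ̃(S)` is infeasible" `=` ONE `𝔽₃`-span (block PERM) gate over the rows MASKED by monotone
wires `v_j ∧ Reach_S(u_y^β, a variable of row j)` (reachability: §17-type `{∧,∨}` circuits) — masking by the
reachability of a row's own variables selects exactly the component's rows; (3) ONE `𝔽₂`-span gate over the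
sign rows (switched by the inputs) and the pin rows `s_y = 1-β` (switched by the wires `Inf(y,β)`): it fires
iff every sign solution meets an infeasible sheet, i.e. iff UNSAT. So `S₃` should PASS the door test; the
linearisation uses the sign TIES (coupled coordinates share one class bit, from `P`-stability of `W` over
`𝔽₃`) — over `ℤ/4`-sections (`D₄ ⊇ ⟨ρ⟩ ≅ ℤ/4`) couplings through the 2-torsion, e.g.
`W = ⟨(ρ, ρ²)⟩ ⋊ ⟨(τ,1),(1,τ)⟩ ≤ D₄²` (binary, relational, signs untied), defeat it: sheets of the cover get
polluted. EVEN twists `2[s]` still linearise (`2[s] = 2σ` for any `ℤ/4`-lift `σ` of the bit, and the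
`𝔽₂`-sign system is `2·(ℤ/4-system)`), so menus all of whose constraints are `ℤ/4`-affine in `(u, 2σ)` are ONE
`ℤ/4`-LIN gate (Stub 2, `m = 4`); the residue of the door test consists of (i) ODD bit couplings `u = c ± [s]`
(cosets of the diagonal reflections `⟨ρτ⟩, ⟨ρ³τ⟩`, already unary; a brute-force check finds no
`(u, 2σ)`-linearisation for them) and (ii) twist cocycles with a QUADRATIC part `2[s₁][s₂]·n ≠ 0` (possible
since `(e₁-1)·t(e₂) ∈ 2M` need not vanish mod `W`) — the natural dual candidate for both being membership in
subgroups of `D₄^N` (class 2: commutators supply the bilinear terms) generated by selected elements, i.e. a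
genuinely NONABELIAN PERM gate. [folklore] -/
theorem PermCSP.not_sat_iff_bad (S : Set J) : ¬ P.Sat S ↔ P.Bad S :=
  ⟨fun h => by_contra fun hb => h (PermCSP.sat_of_not_bad hb), PermCSP.not_sat_of_bad⟩

/-- The link with COSET gates: a binary coset constraint whose subgroup is the GRAPH of a bijection
`φ` of `G` (holonomy = graph of the identity, automorphism twists, …) is a permutation constraint —
`(a, b)⁻¹ · (u, w) ∈ graph φ ↔ w = b · φ (a⁻¹ · u)`. [folklore] -/
theorem mem_coset_graph_iff {G : Type*} [Group G] (φ : G ≃ G) (H : Subgroup (G × G))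
    (hH : ∀ p : G × G, p ∈ H ↔ p.2 = φ p.1) (a b u w : G) :
    (a, b)⁻¹ * (u, w) ∈ H ↔ w = b * φ (a⁻¹ * u) := by
  rw [hH, Prod.inv_mk, Prod.mk_mul_mk]
  exact inv_mul_eq_iff_eq_mul

end PermCSP

end Summit.PneNP.PneNP.Theorems.Capture.Negative
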